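import Literature.NumberTheory.Automorphic.CMBorelUnipotentIndexModulus
import Literature.NumberTheory.Automorphic.SquareIntegrableRayCoefficientDecay
import HarnessLib

/-!
# Lower bound for the shells of a SMALL compact open `K` modulo a compact centre: `μZ((K aᵐ K)Z∕Z) ≥ c₀ · δ_P(a)⁻ᵐ`
# (Casselman 1995, Lemma 1.5.1, Thm. 4.4.6 «⇒»; Deitmar–Echterhoff Thm. 1.5.3)

Topic `NumberTheory/Automorphic`; namespace `Literature.NumberTheory.Automorphic.DoubleCosetIndex` (+ a CM corollary in
`Literature.NumberTheory.Automorphic.UnitaryGroup`).  THEOREMS ONLY (no definition, no named fact, no instance, no notation, no `sorry`).  Cell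
`hodgecm-mathlib`, F0∕P3 «U3-mult», N5 road (★ `UnitaryGroup.U3SquareIntegrableExponents` [Casselman1995, Thm. 4.4.6]), file (R3f) of the GROUP∕MEASURE
half (seat B-p04 (g31)): the `hvol` binder of the «⇒» half ★ `Representation.norm_sq_mul_lt_one_of_isSquareIntegrableModCenter` (F0P3-p01's R4) —
`∀ m, ENNReal.ofReal (c₀ * D ^ m) ≤ μZ (mk '' (K · {aᵐ} · K))` with `c₀ > 0`, `D = δ_P(a)⁻¹` — for a compact open `K` NOT containing the centre
(the Iwahori levels of the road are small), obtained by composing the `G`-side growth ★ `DoubleCosetIndex.smul_measure_le_measure_doubleCoset`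
(`δ_P(a)⁻ᵐ · μG(K) ≤ μG(K aᵐ K)`, no factorisation) with the `G → G ⧸ Z(G)` transfer for a COMPACT centre ★
`RayCoefficient.exists_pos_forall_mul_le_measure_image_mk` (`s · μG(A) ≤ μZ(A Z∕Z)`, F0P3a-p04).

* §1 **`exists_pos_ofReal_mul_inv_pow_le_measure_image_mk`** (generic: `G` locally compact, `Z(G)` compact, `μG`, `μZ` Haar; `K` compact open, `N` closed
  with a Haar measure `μN`, `a` with `a^{±1}Na^{∓1} ⊆ N`, `a(K ∩ N)a⁻¹ ⊆ K`, conjugations `ψ m` scaling `μN` by `(d⁻¹)ᵐ`).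
* §2 **`UnitaryGroup.exists_pos_ofReal_mul_modularCharacter_inv_pow_le_cmBorel`** (CM carrier `U(Φ₃)(L⁺_v)`, `t ∈ T`, any compact open `K` with
  `t(K ∩ N)t⁻¹ ⊆ K`, `d = Δ_B(t)`; the compactness of the centre at a non-split `v` is the consumer's ★ `isCompact_center_cmLocal_of_nonsplit`).
HC_CM is proved only modulo the printed citations until rung 0 closes; count-neutral.

## References
* [Casselman1995] W. Casselman, *Introduction to the theory of admissible representations of `p`-adic reductive groups* (draft 1 May 1995),
  §1.5 Lemma 1.5.1 p. 16, Thm. 4.4.6 p. 45.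
* [DeitmarEchterhoff2014] A. Deitmar, S. Echterhoff, *Principles of Harmonic Analysis*, 2nd ed. (2014), Thm. 1.5.3 (quotient measures).
* [Rogawski1990] J. D. Rogawski, *Automorphic Representations of Unitary Groups in Three Variables* (1990), §2.2.
-/

set_option autoImplicit false

noncomputable section

open MeasureTheory Measure
open scoped NNReal ENNReal Pointwise MatrixGroups

namespace Literature.NumberTheory.Automorphic

namespace DoubleCosetIndex

variable {G : Type*} [Group G] [TopologicalSpace G] [IsTopologicalGroup G] [LocallyCompactSpace G] [MeasurableSpace G] [BorelSpace G]
  [MeasurableSpace (G ⧸ Subgroup.center G)] [BorelSpace (G ⧸ Subgroup.center G)] {K N : Subgroup G} {a : G}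

/-- **`∃ c₀ > 0, ∀ m, ENNReal.ofReal (c₀ · d⁻¹ ^ m) ≤ μZ((K aᵐ K)Z∕Z)`** — the «⇒» volume binder for a SMALL compact open `K` when the centre is
compact: `μZ((K aᵐ K)Z∕Z) ≥ s · μG(K aᵐ K)` (★ `RayCoefficient.exists_pos_forall_mul_le_measure_image_mk`) `≥ s · δ⁻ᵐ · μG(K)` (★
`smul_measure_le_measure_doubleCoset`, `δ⁻ᵐ = (d⁻¹)ᵐ` the radical's Haar scaling of `n ↦ aᵐ n a⁻ᵐ`); `c₀ = s · μG(K)`.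
[cite: Casselman1995, §1.5 Lemma 1.5.1 p. 16, Thm. 4.4.6 p. 45] [cite: DeitmarEchterhoff2014, Thm. 1.5.3] -/
theorem exists_pos_ofReal_mul_inv_pow_le_measure_image_mk (hZ : IsCompact (Subgroup.center G : Set G))
    (μG : Measure G) [μG.IsHaarMeasure] (μZ : Measure (G ⧸ Subgroup.center G)) [μZ.IsHaarMeasure]
    (hKo : IsOpen (K : Set G)) (hKc : IsCompact (K : Set G)) (hNc : IsClosed (N : Set G)) [MeasurableSpace ↥N] [BorelSpace ↥N]
    (μN : Measure ↥N) [μN.IsHaarMeasure] (haKN : ∀ n ∈ K ⊓ N, a * n * a⁻¹ ∈ K) (haN : ∀ n ∈ N, a⁻¹ * n * a ∈ N)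
    (haN' : ∀ n ∈ N, a * n * a⁻¹ ∈ N) (ψ : ℕ → ↥N → ↥N) (hψ : ∀ (m : ℕ) (n : ↥N), ((ψ m n : ↥N) : G) = a ^ m * n * (a ^ m)⁻¹)
    {d : ℝ≥0} (hμN : ∀ m : ℕ, μN.map (ψ m) = ((d⁻¹ ^ m : ℝ≥0) : ℝ≥0∞) • μN) :
    ∃ c₀ : ℝ, 0 < c₀ ∧ ∀ m : ℕ,
      ENNReal.ofReal (c₀ * ((d : ℝ)⁻¹) ^ m) ≤ μZ ((QuotientGroup.mk : G → G ⧸ Subgroup.center G) '' ((K : Set G) * {a ^ m} * (K : Set G))) := by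
  obtain ⟨s, hs, hsle⟩ := RayCoefficient.exists_pos_forall_mul_le_measure_image_mk hZ μG μZ
  have hK0 : μG K ≠ 0 := (hKo.measure_pos μG ⟨1, K.one_mem⟩).ne'
  have hKtop : μG K ≠ ∞ := hKc.measure_lt_top.ne
  refine ⟨(s : ℝ) * μG.real K, mul_pos (NNReal.coe_pos.2 hs) (ENNReal.toReal_pos hK0 hKtop), fun m => ?_⟩
  have hvol : (((d⁻¹ ^ m : ℝ≥0)) : ℝ≥0∞) * μG K ≤ μG (DoubleCoset.doubleCoset (a ^ m) (K : Set G) K) :=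
    smul_measure_le_measure_doubleCoset μG hKo hKc hNc μN (b := a ^ m) (forall_pow_mul_mul_pow_inv_mem_K_of_forall haKN haN' m)
      (forall_pow_inv_mul_mul_pow_mem_of_forall haN m) (forall_pow_mul_mul_pow_inv_mem_of_forall haN' m) (ψ m) (hψ m) (hμN m)
  have hcl : IsCompact (closure (DoubleCoset.doubleCoset (a ^ m) (K : Set G) K)) := (isCompact_doubleCoset hKc (a ^ m)).closure
  have htr := hsle _ hcl
  have hofReal : ENNReal.ofReal ((s : ℝ) * μG.real K * ((d : ℝ)⁻¹) ^ m) = (s : ℝ≥0∞) * ((((d⁻¹ ^ m : ℝ≥0)) : ℝ≥0∞) * μG K) := by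
    have hreal : (s : ℝ) * μG.real K * ((d : ℝ)⁻¹) ^ m = ((s * d⁻¹ ^ m : ℝ≥0) : ℝ) * μG.real K := by push_cast; ring
    rw [hreal, ENNReal.ofReal_mul (NNReal.coe_nonneg _), ENNReal.ofReal_coe_nnreal, measureReal_def, ENNReal.ofReal_toReal hKtop,
      ENNReal.coe_mul, mul_assoc]
  calc ENNReal.ofReal ((s : ℝ) * μG.real K * ((d : ℝ)⁻¹) ^ m) = (s : ℝ≥0∞) * ((((d⁻¹ ^ m : ℝ≥0)) : ℝ≥0∞) * μG K) := hofReal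
    _ ≤ (s : ℝ≥0∞) * μG (DoubleCoset.doubleCoset (a ^ m) (K : Set G) K) := by gcongr
    _ ≤ μZ ((QuotientGroup.mk : G → G ⧸ Subgroup.center G) '' DoubleCoset.doubleCoset (a ^ m) (K : Set G) K) := htr

end DoubleCosetIndex

/-! ## §2 The CM carrier `U(Φ₃)(L⁺_v)` -/

namespace UnitaryGroup

open _root_.NumberField _root_.IsDedekindDomain

variable (L : Type) [Field L] [NumberField L] [IsCMField L] (v : HeightOneSpectrum (𝓞 ↥(maximalRealSubfield L)))

/-- **The «⇒» volume binder at the CM carrier**: for `t ∈ T(L⁺_v)`, any compact open `K ≤ U(Φ₃)(L⁺_v)` with `t(K ∩ N)t⁻¹ ⊆ K`, Haar measures `μG`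
on `G` and `μZ` on `G ⧸ Z(G)`, and a COMPACT centre (true at non-split `v`; the consumer's ★ `isCompact_center_cmLocal_of_nonsplit`):
`∃ c₀ > 0, ∀ m, ENNReal.ofReal (c₀ · (Δ_B t)⁻¹ ^ m) ≤ μZ((K tᵐ K)Z∕Z)` (§1 with ★ `map_torusConj_pow_inv_cmBorel`, ★ `coe_torusConj_pow_inv`).
[cite: Casselman1995, §1.5 Lemma 1.5.1 p. 16, Thm. 4.4.6 p. 45] [cite: Rogawski1990, §2.2] -/
theorem exists_pos_ofReal_mul_modularCharacter_inv_pow_le_cmBorel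
    [MeasurableSpace ↥(unitaryGroupOfForm (conjLocal L (IsCMField.complexConj L) v) (cmLocalForm L 3 v))]
    [BorelSpace ↥(unitaryGroupOfForm (conjLocal L (IsCMField.complexConj L) v) (cmLocalForm L 3 v))]
    [MeasurableSpace (↥(unitaryGroupOfForm (conjLocal L (IsCMField.complexConj L) v) (cmLocalForm L 3 v)) ⧸
      Subgroup.center ↥(unitaryGroupOfForm (conjLocal L (IsCMField.complexConj L) v) (cmLocalForm L 3 v)))]
    [BorelSpace (↥(unitaryGroupOfForm (conjLocal L (IsCMField.complexConj L) v) (cmLocalForm L 3 v)) ⧸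
      Subgroup.center ↥(unitaryGroupOfForm (conjLocal L (IsCMField.complexConj L) v) (cmLocalForm L 3 v)))]
    (hZ : IsCompact (Subgroup.center ↥(unitaryGroupOfForm (conjLocal L (IsCMField.complexConj L) v) (cmLocalForm L 3 v)) :
      Set ↥(unitaryGroupOfForm (conjLocal L (IsCMField.complexConj L) v) (cmLocalForm L 3 v))))
    (μG : Measure ↥(unitaryGroupOfForm (conjLocal L (IsCMField.complexConj L) v) (cmLocalForm L 3 v))) [μG.IsHaarMeasure]
    (μZ : Measure (↥(unitaryGroupOfForm (conjLocal L (IsCMField.complexConj L) v) (cmLocalForm L 3 v)) ⧸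
      Subgroup.center ↥(unitaryGroupOfForm (conjLocal L (IsCMField.complexConj L) v) (cmLocalForm L 3 v)))) [μZ.IsHaarMeasure]
    (K : Subgroup ↥(unitaryGroupOfForm (conjLocal L (IsCMField.complexConj L) v) (cmLocalForm L 3 v)))
    (hKo : IsOpen (K : Set ↥(unitaryGroupOfForm (conjLocal L (IsCMField.complexConj L) v) (cmLocalForm L 3 v))))
    (hKc : IsCompact (K : Set ↥(unitaryGroupOfForm (conjLocal L (IsCMField.complexConj L) v) (cmLocalForm L 3 v))))
    (t : ↥(torusU (conjLocal L (IsCMField.complexConj L) v) (cmLocalForm L 3 v)))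
    (htK : ∀ n ∈ K ⊓ (cmBorelTriple L 3 v).N,
      (t : ↥(unitaryGroupOfForm (conjLocal L (IsCMField.complexConj L) v) (cmLocalForm L 3 v))) * n *
        (t : ↥(unitaryGroupOfForm (conjLocal L (IsCMField.complexConj L) v) (cmLocalForm L 3 v)))⁻¹ ∈ K) :
    ∃ c₀ : ℝ, 0 < c₀ ∧ ∀ m : ℕ,
      ENNReal.ofReal (c₀ * ((((haveI := locallyCompactSpace_cmBorelU L 3 v;
          (modularCharacter (⟨(t : ↥(unitaryGroupOfForm (conjLocal L (IsCMField.complexConj L) v) (cmLocalForm L 3 v))),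
              torusU_le_borelU _ _ t.2⟩ : ↥(cmBorelTriple L 3 v).P) : ℝ≥0)) : ℝ)⁻¹) ^ m)) ≤
        μZ ((QuotientGroup.mk : _ → ↥(unitaryGroupOfForm (conjLocal L (IsCMField.complexConj L) v) (cmLocalForm L 3 v)) ⧸
            Subgroup.center ↥(unitaryGroupOfForm (conjLocal L (IsCMField.complexConj L) v) (cmLocalForm L 3 v))) ''
          ((K : Set _) * {(t : ↥(unitaryGroupOfForm (conjLocal L (IsCMField.complexConj L) v) (cmLocalForm L 3 v))) ^ m} * (K : Set _))) := by
  haveI := locallyCompactSpace_cmBorelU L 3 v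
  haveI : LocallyCompactSpace ↥(unitaryGroupOfForm (conjLocal L (IsCMField.complexConj L) v) (cmLocalForm L 3 v)) :=
    locallyCompactSpace_local (IsCMField.complexConj L) 3 _ v
  haveI : SecondCountableTopology ↥(unitaryGroupOfForm (conjLocal L (IsCMField.complexConj L) v) (cmLocalForm L 3 v)) :=
    secondCountableTopology_local (IsCMField.complexConj L) 3 _ v
  have hNcl := isClosed_cmBorelTriple_N L v
  haveI : LocallyCompactSpace ↥(cmBorelTriple L 3 v).N := hNcl.isClosedEmbedding_subtypeVal.locallyCompactSpace
  haveI : SecondCountableTopology ↥(cmBorelTriple L 3 v).N := TopologicalSpace.Subtype.secondCountableTopology _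
  letI : MeasurableSpace ↥(cmBorelTriple L 3 v).N := borel _
  haveI : BorelSpace ↥(cmBorelTriple L 3 v).N := ⟨rfl⟩
  have hnorm : ∀ (s : ↥(torusU (conjLocal L (IsCMField.complexConj L) v) (cmLocalForm L 3 v))) (n), n ∈ (cmBorelTriple L 3 v).N →
      (s : ↥(unitaryGroupOfForm (conjLocal L (IsCMField.complexConj L) v) (cmLocalForm L 3 v)))⁻¹ * n * s ∈ (cmBorelTriple L 3 v).N := by
    intro s n hn
    exact (HeisRing.torusConj (conjLocal L (IsCMField.complexConj L) v) s ⟨n, hn⟩).2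
  have haN' : ∀ n ∈ (cmBorelTriple L 3 v).N,
      (t : ↥(unitaryGroupOfForm (conjLocal L (IsCMField.complexConj L) v) (cmLocalForm L 3 v))) * n * t⁻¹ ∈ (cmBorelTriple L 3 v).N := by
    intro n hn
    have h := hnorm t⁻¹ n hn
    rwa [Subgroup.coe_inv, inv_inv] at h
  exact DoubleCosetIndex.exists_pos_ofReal_mul_inv_pow_le_measure_image_mk hZ μG μZ hKo hKc hNcl
    (Measure.haar : Measure ↥(cmBorelTriple L 3 v).N) htK (fun n hn => hnorm t n hn) haN'
    (fun m => HeisRing.torusConj (conjLocal L (IsCMField.complexConj L) v) (t ^ m)⁻¹) (coe_torusConj_pow_inv L v t)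
    (map_torusConj_pow_inv_cmBorel L v t _)

/-! ## §3 (ED. 2) The REAL ∕ `doubleCoset` spellings of the «⇒» volume binder and the modulus identity `‖δ_P^{1/2}(a)‖² · δ_P(a)⁻¹ = 1` -/

/-- **The «⇒» volume binder of ★ `Representation.norm_exponent_lt_one_of_isSquareIntegrableModCenter` at the CM carrier, REAL spelling**:
`∃ c₀ > 0, ∀ m, c₀ · (Δ_B t)⁻¹ ^ m ≤ μZ.real ((K tᵐ K)Z∕Z)` (Mathlib's `DoubleCoset.doubleCoset (t ^ m) K K = K · {tᵐ} · K`; from the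
`ENNReal.ofReal` form `exists_pos_ofReal_mul_modularCharacter_inv_pow_le_cmBorel`, the shells having finite measure).  Apply it level by level
(`K := 𝓘.K n`) to get the `hvol : ∀ n, ∃ c₀ > 0, ∀ m, …` of the criterion. [cite: Casselman1995, §1.5 Lemma 1.5.1 p. 16, Thm. 4.4.6 p. 45] -/
theorem exists_pos_mul_modularCharacter_inv_pow_le_measureReal_cmBorel
    [MeasurableSpace ↥(unitaryGroupOfForm (conjLocal L (IsCMField.complexConj L) v) (cmLocalForm L 3 v))]
    [BorelSpace ↥(unitaryGroupOfForm (conjLocal L (IsCMField.complexConj L) v) (cmLocalForm L 3 v))]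
    [MeasurableSpace (↥(unitaryGroupOfForm (conjLocal L (IsCMField.complexConj L) v) (cmLocalForm L 3 v)) ⧸
      Subgroup.center ↥(unitaryGroupOfForm (conjLocal L (IsCMField.complexConj L) v) (cmLocalForm L 3 v)))]
    [BorelSpace (↥(unitaryGroupOfForm (conjLocal L (IsCMField.complexConj L) v) (cmLocalForm L 3 v)) ⧸
      Subgroup.center ↥(unitaryGroupOfForm (conjLocal L (IsCMField.complexConj L) v) (cmLocalForm L 3 v)))]
    (hZ : IsCompact (Subgroup.center ↥(unitaryGroupOfForm (conjLocal L (IsCMField.complexConj L) v) (cmLocalForm L 3 v)) :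
      Set ↥(unitaryGroupOfForm (conjLocal L (IsCMField.complexConj L) v) (cmLocalForm L 3 v))))
    (μG : Measure ↥(unitaryGroupOfForm (conjLocal L (IsCMField.complexConj L) v) (cmLocalForm L 3 v))) [μG.IsHaarMeasure]
    (μZ : Measure (↥(unitaryGroupOfForm (conjLocal L (IsCMField.complexConj L) v) (cmLocalForm L 3 v)) ⧸
      Subgroup.center ↥(unitaryGroupOfForm (conjLocal L (IsCMField.complexConj L) v) (cmLocalForm L 3 v)))) [μZ.IsHaarMeasure]
    (K : Subgroup ↥(unitaryGroupOfForm (conjLocal L (IsCMField.complexConj L) v) (cmLocalForm L 3 v)))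
    (hKo : IsOpen (K : Set ↥(unitaryGroupOfForm (conjLocal L (IsCMField.complexConj L) v) (cmLocalForm L 3 v))))
    (hKc : IsCompact (K : Set ↥(unitaryGroupOfForm (conjLocal L (IsCMField.complexConj L) v) (cmLocalForm L 3 v))))
    (t : ↥(torusU (conjLocal L (IsCMField.complexConj L) v) (cmLocalForm L 3 v)))
    (htK : ∀ n ∈ K ⊓ (cmBorelTriple L 3 v).N,
      (t : ↥(unitaryGroupOfForm (conjLocal L (IsCMField.complexConj L) v) (cmLocalForm L 3 v))) * n *
        (t : ↥(unitaryGroupOfForm (conjLocal L (IsCMField.complexConj L) v) (cmLocalForm L 3 v)))⁻¹ ∈ K) :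
    ∃ c₀ : ℝ, 0 < c₀ ∧ ∀ m : ℕ,
      c₀ * ((((haveI := locallyCompactSpace_cmBorelU L 3 v;
          (modularCharacter (⟨(t : ↥(unitaryGroupOfForm (conjLocal L (IsCMField.complexConj L) v) (cmLocalForm L 3 v))),
              torusU_le_borelU _ _ t.2⟩ : ↥(cmBorelTriple L 3 v).P) : ℝ≥0)) : ℝ)⁻¹) ^ m) ≤
        μZ.real ((QuotientGroup.mk : _ → ↥(unitaryGroupOfForm (conjLocal L (IsCMField.complexConj L) v) (cmLocalForm L 3 v)) ⧸
            Subgroup.center ↥(unitaryGroupOfForm (conjLocal L (IsCMField.complexConj L) v) (cmLocalForm L 3 v))) ''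
          DoubleCoset.doubleCoset ((t : ↥(unitaryGroupOfForm (conjLocal L (IsCMField.complexConj L) v) (cmLocalForm L 3 v))) ^ m)
            (K : Set _) K) := by
  obtain ⟨c₀, hc₀, h⟩ := exists_pos_ofReal_mul_modularCharacter_inv_pow_le_cmBorel L v hZ μG μZ K hKo hKc t htK
  refine ⟨c₀, hc₀, fun m => ?_⟩
  have hcpt : IsCompact ((QuotientGroup.mk : _ → ↥(unitaryGroupOfForm (conjLocal L (IsCMField.complexConj L) v) (cmLocalForm L 3 v)) ⧸
      Subgroup.center ↥(unitaryGroupOfForm (conjLocal L (IsCMField.complexConj L) v) (cmLocalForm L 3 v))) ''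
        DoubleCoset.doubleCoset ((t : ↥(unitaryGroupOfForm (conjLocal L (IsCMField.complexConj L) v) (cmLocalForm L 3 v))) ^ m)
          (K : Set _) K) :=
    (DoubleCosetIndex.isCompact_doubleCoset hKc _).image continuous_quot_mk
  exact (ENNReal.ofReal_le_iff_le_toReal hcpt.measure_lt_top.ne).1 (h m)

/-- **The modulus identity of the criterion** (the `hδD` binder of ★ `Representation.norm_exponent_lt_one_of_isSquareIntegrableModCenter` ∕
`isSquareIntegrableModCenter_of_forall_norm_exponent_lt_one` with `D := (Δ_P a)⁻¹`): `‖δ_P^{1/2}(a)‖² · (Δ_P a)⁻¹ = 1` for the tree's ★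
`rootDeltaChar P` (`= √Δ_P`, ★ `rootDeltaChar_apply`) — any locally compact group, any closed subgroup `P`, any `a ∈ P`.  With ★
`modularCharacter_cmBorel_eq_relIndex_inv` the same `D` is `[K ∩ N : a(K ∩ N)a⁻¹]` at every level. [cite: Casselman1995, §1.5, Thm. 4.4.6 p. 45] -/
theorem _root_.Literature.NumberTheory.Automorphic.norm_rootDeltaChar_sq_mul_modularCharacter_inv {G : Type*} [Group G] [TopologicalSpace G]
    [IsTopologicalGroup G] (P : Subgroup G) [LocallyCompactSpace ↥P] (a : ↥P) :
    ‖((rootDeltaChar P a : ℂˣ) : ℂ)‖ ^ 2 * (((modularCharacter a : ℝ≥0) : ℝ))⁻¹ = 1 := by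
  have hne : ((modularCharacter a : ℝ≥0) : ℝ) ≠ 0 := by
    have h1 : modularCharacter a * modularCharacter a⁻¹ = 1 := by rw [← map_mul, mul_inv_cancel, map_one]
    exact_mod_cast left_ne_zero_of_mul_eq_one h1
  rw [rootDeltaChar_apply, Complex.norm_real, Real.norm_of_nonneg (NNReal.coe_nonneg _), ← NNReal.coe_pow, NNReal.sq_sqrt,
    mul_inv_cancel₀ hne]

end UnitaryGroup

end Literature.NumberTheory.Automorphic
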